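import Literature.NumberTheory.Sieve.SmoothBVCore
import Literature.NumberTheory.Sieve.TotientHarmonic
import HarnessLib

/-!
# From all non-principal characters to primitive ones (Hinz 1988, §2 pp. 177–178, smooth form)

Topic `Literature/NumberTheory/Sieve`, sub-namespace `SmoothBVModuli`. Hinz, p. 177–178: every
`χ ≠ χ₀ mod 𝔮` is induced by a primitive `χ* mod 𝔮*`, `𝔮* ∣ 𝔮`, `𝔮* ≠ 1`; the sums differ by the
contribution of the `α` not prime to `𝔮` (`≪ log^r y · log N𝔮`), and regrouping `𝔮 = 𝔮*𝔮'` costs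
`∑_{N𝔮'≤Q} 1/Φ(𝔮*𝔮') ≪ log Q/Φ(𝔮*)`. For the smooth sums `ψ_Ω(χ)` of `SmoothBVCore` this file
proves (`sum_nonprincipal_le`):

`∑_{N𝔮≤Q} (1/φ(𝔮)) ∑_{χ≠χ₀ mod 𝔮} |ψ_Ω(χ)|`
`  ≤ (∑_{N𝔤≤Q} 1/φ(𝔤)) · ∑_{N𝔣≤Q, 𝔣≠1} (1/φ(𝔣)) ∑*_ψ |ψ_Ω(ψ)| + ∑_{N𝔮≤Q} bad(𝔮)`,

with the tree's `PrimRed.sum_norm_charSum_le` / `sum_inv_totient_sum_divisors_le`, together with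
the bound `bad(𝔮) ≤ K_∞^d C_g (1+log M)^{r} (log₂⌊M^d⌋ + 1) log N𝔮` for the non-coprime part
(`badSum_le`: the `α` with `Λ((α)) ≠ 0` not prime to `𝔮` generate prime powers `𝔭^k ∣ 𝔮^{K₀}`,
`∑_{𝔟∣𝔮^{K₀}} Λ(𝔟) = K₀ log N𝔮`), and the splitting of the primitive side at `Q₁`
(`sum_primitive_split`): the range `Q₁ < N𝔣 ≤ Q` is `SmoothBVCore.smoothBV_core`, the range
`N𝔣 ≤ Q₁` (small moduli, Siegel–Walfisz over `K`) is kept as the explicit term `smallModuli`.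

## References

* J. Hinz, Acta Arith. 51 (1988), §2 pp. 177–178. [cite: Hinz1988, §2 pp. 177–178]
-/

noncomputable section

open Finset NumberField NumberField.InfinitePlace MeasureTheory UniqueFactorizationMonoid
  Literature.NumberTheory.Sieve.NumberFieldLS Literature.NumberTheory.Sieve.BoxPrimes
  Literature.NumberTheory.Sieve.NumberFieldVaughan Literature.NumberTheory.Sieve.MitsuiPNT
  Literature.NumberTheory.LFunctions Literature.NumberTheory.LFunctions.NumberField
  Literature.NumberTheory.Sieve.CastilloEtAl2015 Literature.NumberTheory.Sieve.TypeTwoReparam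
  Literature.NumberTheory.Sieve.TypeTwoCoeff Literature.NumberTheory.Sieve.TypeTwoBlock
  Literature.NumberTheory.Sieve.SmoothBVCore Literature.NumberTheory.Sieve.PrimRed
  Literature.NumberTheory.Sieve.MaynardNF Literature.NumberTheory.Sieve.TotientHarmonic
open scoped Classical

namespace Literature.NumberTheory.Sieve.SmoothBVModuli

variable {K : Type*} [Field K] [NumberField K] [IsTotallyReal K]

local notation "d" => Module.finrank ℚ K
local notation "RP" => {w : InfinitePlace K // IsReal w}
local notation "rk" => Module.finrank ℝ (NumberField.Units.dirichletUnitTheorem.logSpace K)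

/-! ## `ψ_Ω` as a `charSum` -/

variable (K) in
/-- The weight `W(α) = Ω(α) Λ((α))`. [folklore] -/
def W (k : ℝ → ℝ) (M : ℝ) (α : 𝓞 K) : ℂ :=
  weightΩ K (fun v => (k v : ℂ)) M α * (idealVonMangoldt (Ideal.span {α}) : ℂ)

omit [IsTotallyReal K] in
/-- `ψ_Ω(χ) = S_𝔣(χ)` in the notation of `PrimRed.charSum`. [folklore] -/
theorem psiΩ_eq_charSum {𝔣 : Ideal (𝓞 K)} (χ : AddChar (Additive ((𝓞 K ⧸ 𝔣)ˣ)) ℂ) (k : ℝ → ℝ) (M : ℝ) :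
    psiΩ K χ k M = charSum (cubeF K M) (W K k M) 𝔣 χ := by
  unfold psiΩ charSum W
  exact Finset.sum_congr rfl fun α _ => by ring

/-! ## The non-coprime part -/

omit [IsTotallyReal K] in
/-- A nonzero ideal with `Λ(𝔞) ≠ 0` not coprime to `𝔮` divides `𝔮^{K₀}` as soon as
`2^{K₀} > N𝔞`. [folklore] -/
theorem dvd_pow_of_vonMangoldt_ne_zero {𝔞 𝔮 : Ideal (𝓞 K)} (h𝔞 : 𝔞 ≠ ⊥)
    (hΛ : idealVonMangoldt 𝔞 ≠ 0) (hcop : 𝔞 ⊔ 𝔮 ≠ ⊤) {K₀ : ℕ} (hK₀ : Ideal.absNorm 𝔞 < 2 ^ K₀) :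
    𝔞 ∣ 𝔮 ^ K₀ := by
  -- `𝔞 = P^k`
  have hcard : (normalizedFactors 𝔞).toFinset.card = 1 := by
    by_contra h; exact hΛ (idealVonMangoldt_eq_zero h)
  obtain ⟨P, hP⟩ := Finset.card_eq_one.1 hcard
  have hPmem : P ∈ normalizedFactors 𝔞 := by
    have : P ∈ (normalizedFactors 𝔞).toFinset := by rw [hP]; exact Finset.mem_singleton_self P
    exact Multiset.mem_toFinset.1 this
  have hPprime : Prime P := prime_of_normalized_factor P hPmem
  have hall : ∀ Q ∈ normalizedFactors 𝔞, Q = P := fun Q hQ => by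
    have : Q ∈ (normalizedFactors 𝔞).toFinset := Multiset.mem_toFinset.2 hQ
    rw [hP] at this; exact Finset.mem_singleton.1 this
  set k := Multiset.card (normalizedFactors 𝔞) with hk
  have hrep : normalizedFactors 𝔞 = Multiset.replicate k P := Multiset.eq_replicate.2 ⟨rfl, hall⟩
  have h𝔞eq : 𝔞 = P ^ k := by
    have := associated_iff_eq.1 (prod_normalizedFactors h𝔞)
    rw [hrep, Multiset.prod_replicate] at this
    exact this.symm
  -- `P ∣ 𝔮`
  obtain ⟨𝔪, h𝔪max, hle⟩ := Ideal.exists_le_maximal _ hcop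
  have hk0 : k ≠ 0 := by
    intro h0
    have : normalizedFactors 𝔞 = 0 := Multiset.card_eq_zero.1 (hk ▸ h0 : Multiset.card (normalizedFactors 𝔞) = 0)
    rw [this] at hcard; simp at hcard
  haveI : 𝔪.IsPrime := h𝔪max.isPrime
  have hP𝔪 : P ≤ 𝔪 := by
    have h1 : P ^ k ≤ 𝔪 := h𝔞eq ▸ (le_sup_left.trans hle)
    exact (Ideal.IsPrime.pow_le_iff hk0).1 h1
  have hPmax : P.IsMaximal := (Ideal.isPrime_of_prime hPprime).isMaximal hPprime.ne_zero
  have hP𝔪eq : P = 𝔪 := hPmax.eq_of_le h𝔪max.ne_top hP𝔪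
  have h𝔮P : 𝔮 ≤ P := hP𝔪eq ▸ (le_sup_right.trans hle)
  have hPdvd : P ∣ 𝔮 := Ideal.dvd_iff_le.2 h𝔮P
  -- `k ≤ K₀`
  have hkK : k ≤ K₀ := by
    by_contra hlt; push Not at hlt
    have hNP : 2 ≤ Ideal.absNorm P := by
      have hne1 := Ideal.absNorm_eq_one_iff.not.2 hPmax.ne_top
      have h1 : 1 ≤ Ideal.absNorm P :=
        Nat.one_le_iff_ne_zero.2 (by rw [Ne, Ideal.absNorm_eq_zero_iff]; exact hPprime.ne_zero)
      omega
    have : 2 ^ K₀ ≤ Ideal.absNorm 𝔞 := by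
      rw [h𝔞eq, map_pow]
      calc 2 ^ K₀ ≤ 2 ^ k := Nat.pow_le_pow_right two_pos hlt.le
        _ ≤ Ideal.absNorm P ^ k := Nat.pow_le_pow_left hNP k
    omega
  rw [h𝔞eq]
  exact (pow_dvd_pow_of_dvd hPdvd k).trans (pow_dvd_pow 𝔮 hkK)

omit [IsTotallyReal K] in
/-- **The non-coprime part of `Λ` up to `X` is tiny**: `∑_{N𝔞≤X, Λ(𝔞)≠0, 𝔞+𝔮≠1} Λ(𝔞) ≤ K₀ log N𝔮`
with `K₀ = log₂⌊X⌋ + 1`. [cite: Hinz1988, §2 (2.1)] -/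
theorem sum_vonMangoldt_not_coprime_le {𝔮 : Ideal (𝓞 K)} (h𝔮 : 𝔮 ≠ ⊥) (X : ℝ) :
    ∑ 𝔞 ∈ (idealsLE K X).filter (fun 𝔞 => 𝔞 ⊔ 𝔮 ≠ ⊤), idealVonMangoldt 𝔞 ≤
      (Nat.log 2 ⌊X⌋₊ + 1 : ℕ) * Real.log (Ideal.absNorm 𝔮) := by
  set K₀ := Nat.log 2 ⌊X⌋₊ + 1 with hK₀
  have h𝔮K : 𝔮 ^ K₀ ≠ ⊥ := pow_ne_zero _ h𝔮
  -- drop the terms with `Λ = 0` and embed into the divisors of `𝔮^{K₀}`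
  have hsub : ∑ 𝔞 ∈ (idealsLE K X).filter (fun 𝔞 => 𝔞 ⊔ 𝔮 ≠ ⊤), idealVonMangoldt 𝔞 ≤
      ∑ 𝔟 ∈ idealDivisors K (𝔮 ^ K₀), idealVonMangoldt 𝔟 := by
    rw [← Finset.sum_filter_ne_zero]
    refine Finset.sum_le_sum_of_subset_of_nonneg (fun 𝔞 h𝔞 => ?_) fun _ _ _ => idealVonMangoldt_nonneg _
    rw [Finset.mem_filter, Finset.mem_filter, mem_idealsLE] at h𝔞
    obtain ⟨⟨⟨h0, hle⟩, hcop⟩, hΛ⟩ := h𝔞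
    rw [mem_idealDivisors h𝔮K]
    refine dvd_pow_of_vonMangoldt_ne_zero h0 hΛ hcop ?_
    -- `N𝔞 ≤ ⌊X⌋ < 2^{K₀}`
    have h1 : Ideal.absNorm 𝔞 ≤ ⌊X⌋₊ := Nat.le_floor hle
    exact lt_of_le_of_lt h1 (Nat.lt_pow_succ_log_self one_lt_two _)
  refine hsub.trans (le_of_eq ?_)
  rw [sum_divisors_idealVonMangoldt h𝔮K (fun B => mem_idealDivisors h𝔮K), map_pow, Nat.cast_pow, Real.log_pow]

/-- **The bad part is small**: `bad(𝔮) = ∑_{α ∈ A₀(M), α not a unit mod 𝔮} |Ω(α)| Λ((α))`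
`≤ K_∞^d C_g (1 + log M)^{r} (log₂⌊M^d⌋ + 1) log N𝔮` (`M ≥ 1`). [cite: Hinz1988, §2 (2.1)] -/
theorem badSum_le {k : ℝ → ℝ} {Kmax : ℝ} (hK : ∀ v, |k v| ≤ Kmax) {Cg : ℝ} (hCg0 : 0 ≤ Cg)
    (hCg : ∀ X : ℝ, 1 ≤ X → ∀ I : Ideal (𝓞 K),
      (Nat.card {α : 𝓞 K // α ∈ box₀ K X ∧ Ideal.span {α} = I} : ℝ) ≤ Cg * (1 + Real.log X) ^ rk)
    {M : ℝ} (hM : 1 ≤ M) {𝔮 : Ideal (𝓞 K)} (h𝔮 : 𝔮 ≠ ⊥) :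
    badSum (cubeF K M) (W K k M) 𝔮 ≤ Kmax ^ d * (Cg * (1 + Real.log M) ^ rk *
      ((Nat.log 2 ⌊M ^ d⌋₊ + 1 : ℕ) * Real.log (Ideal.absNorm 𝔮))) := by
  have hKmax : 0 ≤ Kmax := le_trans (abs_nonneg _) (hK 0)
  unfold badSum
  -- `|W(α)| ≤ K^d Λ((α))`
  have hW : ∀ α, ‖W K k M α‖ ≤ Kmax ^ d * idealVonMangoldt (Ideal.span {α}) := fun α => by
    unfold W
    rw [norm_mul, Complex.norm_real, Real.norm_eq_abs, abs_of_nonneg (idealVonMangoldt_nonneg _)]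
    exact mul_le_mul_of_nonneg_right (norm_weightΩ_le hK M α) (idealVonMangoldt_nonneg _)
  set S := (cubeF K M).filter (fun α => ¬ IsUnit (Ideal.Quotient.mk 𝔮 α)) with hS
  set f : Ideal (𝓞 K) → ℝ := fun 𝔞 => if 𝔞 ⊔ 𝔮 ≠ ⊤ then idealVonMangoldt 𝔞 else 0 with hf
  have hf0 : ∀ 𝔞, 0 ≤ f 𝔞 := fun 𝔞 => by simp only [hf]; split_ifs; exacts [idealVonMangoldt_nonneg _, le_rfl]
  have h1 : ∑ α ∈ S, ‖W K k M α‖ ≤ Kmax ^ d * ∑ α ∈ S, f (Ideal.span {α}) := by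
    rw [Finset.mul_sum]
    refine Finset.sum_le_sum fun α hα => ?_
    have hnu := (Finset.mem_filter.1 hα).2
    rw [isUnit_mk_iff] at hnu
    simp only [hf, if_pos hnu]
    exact hW α
  have h2 := sum_box₀_le_mul_sum_ideals (K := K) hCg0 hCg hM S
    (fun α hα => mem_cubeF.1 (Finset.mem_filter.1 hα).1) f hf0
  have h3 : ∑ 𝔞 ∈ idealsLE K (M ^ d), f 𝔞 ≤ (Nat.log 2 ⌊M ^ d⌋₊ + 1 : ℕ) * Real.log (Ideal.absNorm 𝔮) := by
    have : ∑ 𝔞 ∈ idealsLE K (M ^ d), f 𝔞 = ∑ 𝔞 ∈ (idealsLE K (M ^ d)).filter (fun 𝔞 => 𝔞 ⊔ 𝔮 ≠ ⊤), idealVonMangoldt 𝔞 := by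
      rw [Finset.sum_filter]
    rw [this]
    exact sum_vonMangoldt_not_coprime_le h𝔮 _
  calc ∑ α ∈ S, ‖W K k M α‖ ≤ Kmax ^ d * ∑ α ∈ S, f (Ideal.span {α}) := h1
    _ ≤ Kmax ^ d * (Cg * (1 + Real.log M) ^ rk * ∑ 𝔞 ∈ idealsLE K (M ^ d), f 𝔞) :=
        mul_le_mul_of_nonneg_left h2 (pow_nonneg hKmax _)
    _ ≤ _ := by
        have hlogM := Real.log_nonneg hM
        gcongr

/-! ## The reduction -/

variable (K) in
/-- The non-principal characters mod `𝔮`, as a `Finset` (empty for `𝔮 = 0`). [folklore] -/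
def nonprincipalChars (𝔮 : Ideal (𝓞 K)) : Finset (AddChar (Additive ((𝓞 K ⧸ 𝔮)ˣ)) ℂ) :=
  if h : 𝔮 = ⊥ then ∅ else
    haveI : Finite (𝓞 K ⧸ 𝔮) := Ideal.finiteQuotientOfFreeOfNeBot 𝔮 h
    (Finset.univ : Finset (AddChar (Additive ((𝓞 K ⧸ 𝔮)ˣ)) ℂ)).erase 0

omit [IsTotallyReal K] in
/-- **The reduction to primitive characters, summed over the moduli** (Hinz pp. 177–178, smooth
form): for any nonnegative weights,
`∑_{N𝔮≤Q} φ(𝔮)⁻¹ ∑_{χ≠χ₀} |ψ_Ω(χ)| ≤ (∑_{N𝔤≤Q} φ(𝔤)⁻¹) ∑_{N𝔣≤Q,𝔣≠1} φ(𝔣)⁻¹ ∑*_ψ |ψ_Ω(ψ)| + ∑_{N𝔮≤Q} bad(𝔮)`.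
[cite: Hinz1988, §2 pp. 177–178] -/
theorem sum_nonprincipal_le (k : ℝ → ℝ) (M Q : ℝ) :
    ∑ 𝔮 ∈ idealsLE K Q, (idealTotient K 𝔮)⁻¹ * ∑ χ ∈ nonprincipalChars K 𝔮, ‖psiΩ K χ k M‖ ≤
      (∑ 𝔤 ∈ idealsLE K Q, (idealTotient K 𝔤)⁻¹) *
        (∑ 𝔣 ∈ (idealsLE K Q).filter (· ≠ ⊤), (idealTotient K 𝔣)⁻¹ * ∑ ψ ∈ primChars K 𝔣, ‖psiΩ K ψ k M‖) +
      ∑ 𝔮 ∈ idealsLE K Q, badSum (cubeF K M) (W K k M) 𝔮 := by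
  -- per modulus
  have hper : ∀ 𝔮 ∈ idealsLE K Q, (idealTotient K 𝔮)⁻¹ * ∑ χ ∈ nonprincipalChars K 𝔮, ‖psiΩ K χ k M‖ ≤
      (idealTotient K 𝔮)⁻¹ * (∑ 𝔣 ∈ (idealDivisors K 𝔮).filter (· ≠ ⊤), ∑ ψ ∈ primChars K 𝔣, ‖psiΩ K ψ k M‖) +
        badSum (cubeF K M) (W K k M) 𝔮 := by
    intro 𝔮 h𝔮
    have h𝔮0 := (mem_idealsLE.1 h𝔮).1
    haveI : Finite (𝓞 K ⧸ 𝔮) := Ideal.finiteQuotientOfFreeOfNeBot 𝔮 h𝔮0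
    letI : Fintype (𝓞 K ⧸ 𝔮) := Fintype.ofFinite _
    have hφ := idealTotient_pos (K := K) h𝔮0
    have hnp : nonprincipalChars K 𝔮 = (Finset.univ : Finset (AddChar (Additive ((𝓞 K ⧸ 𝔮)ˣ)) ℂ)).erase 0 := by
      rw [nonprincipalChars, dif_neg h𝔮0]
    have hmain := sum_norm_charSum_le (B := cubeF K M) (W := W K k M) h𝔮0
    simp_rw [← psiΩ_eq_charSum] at hmain
    rw [hnp]
    have hmain' : ∑ χ ∈ (Finset.univ : Finset (AddChar (Additive ((𝓞 K ⧸ 𝔮)ˣ)) ℂ)).erase 0, ‖psiΩ K χ k M‖ ≤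
        (∑ 𝔣 ∈ (idealDivisors K 𝔮).filter (· ≠ ⊤), ∑ ψ ∈ primChars K 𝔣, ‖psiΩ K ψ k M‖) +
          Fintype.card (AddChar (Additive ((𝓞 K ⧸ 𝔮)ˣ)) ℂ) * badSum (cubeF K M) (W K k M) 𝔮 := by
      convert hmain using 2
    -- `#chars ≤ φ(𝔮)`
    have hcard : (Fintype.card (AddChar (Additive ((𝓞 K ⧸ 𝔮)ˣ)) ℂ) : ℝ) ≤ idealTotient K 𝔮 := by
      rw [idealTotient_eq_natCard_units h𝔮0, Nat.card_eq_fintype_card]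
      have h2 : Fintype.card (AddChar (Additive ((𝓞 K ⧸ 𝔮)ˣ)) ℂ) ≤ Fintype.card (Additive ((𝓞 K ⧸ 𝔮)ˣ)) :=
        AddChar.card_addChar_le _ _
      rw [Fintype.card_congr (Additive.ofMul (α := (𝓞 K ⧸ 𝔮)ˣ)).symm] at h2
      exact_mod_cast h2
    have hbad := badSum_nonneg (cubeF K M) (W K k M) 𝔮
    calc (idealTotient K 𝔮)⁻¹ * ∑ χ ∈ (Finset.univ : Finset (AddChar (Additive ((𝓞 K ⧸ 𝔮)ˣ)) ℂ)).erase 0, ‖psiΩ K χ k M‖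
        ≤ (idealTotient K 𝔮)⁻¹ * ((∑ 𝔣 ∈ (idealDivisors K 𝔮).filter (· ≠ ⊤), ∑ ψ ∈ primChars K 𝔣, ‖psiΩ K ψ k M‖) +
            Fintype.card (AddChar (Additive ((𝓞 K ⧸ 𝔮)ˣ)) ℂ) * badSum (cubeF K M) (W K k M) 𝔮) :=
          mul_le_mul_of_nonneg_left hmain' (inv_nonneg.2 hφ.le)
      _ = (idealTotient K 𝔮)⁻¹ * (∑ 𝔣 ∈ (idealDivisors K 𝔮).filter (· ≠ ⊤), ∑ ψ ∈ primChars K 𝔣, ‖psiΩ K ψ k M‖) +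
            ((idealTotient K 𝔮)⁻¹ * Fintype.card (AddChar (Additive ((𝓞 K ⧸ 𝔮)ˣ)) ℂ)) * badSum (cubeF K M) (W K k M) 𝔮 := by
          ring
      _ ≤ (idealTotient K 𝔮)⁻¹ * (∑ 𝔣 ∈ (idealDivisors K 𝔮).filter (· ≠ ⊤), ∑ ψ ∈ primChars K 𝔣, ‖psiΩ K ψ k M‖) +
            1 * badSum (cubeF K M) (W K k M) 𝔮 := by
          gcongr
          rw [inv_mul_le_iff₀ hφ, mul_one]; exact hcard
      _ = _ := by rw [one_mul]
  refine (Finset.sum_le_sum hper).trans ?_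
  rw [Finset.sum_add_distrib]
  refine add_le_add ?_ le_rfl
  exact sum_inv_totient_sum_divisors_le Q (fun 𝔣 => ∑ ψ ∈ primChars K 𝔣, ‖psiΩ K ψ k M‖)
    fun 𝔣 => Finset.sum_nonneg fun _ _ => norm_nonneg _

omit [IsTotallyReal K] in
/-- **Splitting the primitive side at `Q₁`**: the moduli `N𝔣 ≤ Q₁` (small) and `Q₁ < N𝔣 ≤ Q`
(large; the left-hand side of `SmoothBVCore.smoothBV_core`). [cite: Hinz1988, §2 p. 178] -/
theorem sum_primitive_split (k : ℝ → ℝ) (M Q₁ Q : ℝ) :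
    ∑ 𝔣 ∈ (idealsLE K Q).filter (· ≠ ⊤), (idealTotient K 𝔣)⁻¹ * ∑ ψ ∈ primChars K 𝔣, ‖psiΩ K ψ k M‖ ≤
      (∑ 𝔣 ∈ (idealsLE K Q₁).filter (· ≠ ⊤), (idealTotient K 𝔣)⁻¹ * ∑ ψ ∈ primChars K 𝔣, ‖psiΩ K ψ k M‖) +
      ∑ 𝔣 ∈ (idealsLE K Q).filter (fun 𝔣 => Q₁ < Ideal.absNorm 𝔣),
        (∑ ψ ∈ primChars K 𝔣, ‖psiΩ K ψ k M‖) / Nat.card ((𝓞 K ⧸ 𝔣)ˣ) := by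
  have hnn : ∀ 𝔣 ∈ (idealsLE K Q).filter (· ≠ ⊤), 0 ≤ (idealTotient K 𝔣)⁻¹ * ∑ ψ ∈ primChars K 𝔣, ‖psiΩ K ψ k M‖ := by
    intro 𝔣 h𝔣
    have h0 := (mem_idealsLE.1 (Finset.mem_filter.1 h𝔣).1).1
    exact mul_nonneg (inv_nonneg.2 (idealTotient_pos (K := K) h0).le) (Finset.sum_nonneg fun _ _ => norm_nonneg _)
  -- split the index set
  have hsplit : (idealsLE K Q).filter (· ≠ ⊤) ⊆
      ((idealsLE K Q₁).filter (· ≠ ⊤)) ∪ ((idealsLE K Q).filter (fun 𝔣 => Q₁ < Ideal.absNorm 𝔣)) := by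
    intro 𝔣 h𝔣
    rw [Finset.mem_filter, mem_idealsLE] at h𝔣
    rw [Finset.mem_union, Finset.mem_filter, Finset.mem_filter, mem_idealsLE, mem_idealsLE]
    by_cases h : (Ideal.absNorm 𝔣 : ℝ) ≤ Q₁
    · exact Or.inl ⟨⟨h𝔣.1.1, h⟩, h𝔣.2⟩
    · exact Or.inr ⟨h𝔣.1, lt_of_not_ge h⟩
  have hnn' : ∀ 𝔣 ∈ ((idealsLE K Q₁).filter (· ≠ ⊤)) ∪ ((idealsLE K Q).filter (fun 𝔣 => Q₁ < Ideal.absNorm 𝔣)),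
      0 ≤ (idealTotient K 𝔣)⁻¹ * ∑ ψ ∈ primChars K 𝔣, ‖psiΩ K ψ k M‖ := by
    intro 𝔣 h𝔣
    have h0 : 𝔣 ≠ ⊥ := by
      rcases Finset.mem_union.1 h𝔣 with h | h
      · exact (mem_idealsLE.1 (Finset.mem_filter.1 h).1).1
      · exact (mem_idealsLE.1 (Finset.mem_filter.1 h).1).1
    exact mul_nonneg (inv_nonneg.2 (idealTotient_pos (K := K) h0).le) (Finset.sum_nonneg fun _ _ => norm_nonneg _)
  refine (Finset.sum_le_sum_of_subset_of_nonneg hsplit fun 𝔣 h _ => hnn' 𝔣 h).trans ?_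
  set A := (idealsLE K Q₁).filter (· ≠ ⊤) with hA
  set B := (idealsLE K Q).filter (fun 𝔣 => Q₁ < Ideal.absNorm 𝔣) with hB
  set g : Ideal (𝓞 K) → ℝ := fun 𝔣 => (idealTotient K 𝔣)⁻¹ * ∑ ψ ∈ primChars K 𝔣, ‖psiΩ K ψ k M‖ with hg
  have hui := Finset.sum_union_inter (s₁ := A) (s₂ := B) (f := g)
  have hint : 0 ≤ ∑ 𝔣 ∈ A ∩ B, g 𝔣 :=
    Finset.sum_nonneg fun 𝔣 h => hnn' 𝔣 (Finset.mem_union_left _ (Finset.mem_inter.1 h).1)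
  have hBeq : ∑ 𝔣 ∈ B, g 𝔣 = ∑ 𝔣 ∈ B, (∑ ψ ∈ primChars K 𝔣, ‖psiΩ K ψ k M‖) / Nat.card ((𝓞 K ⧸ 𝔣)ˣ) := by
    refine Finset.sum_congr rfl fun 𝔣 h𝔣 => ?_
    have h0 := (mem_idealsLE.1 (Finset.mem_filter.1 h𝔣).1).1
    simp only [hg]
    rw [idealTotient_eq_natCard_units h0, div_eq_inv_mul]
  rw [← hBeq]
  linarith

end Literature.NumberTheory.Sieve.SmoothBVModuli
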